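import Summits.ResolutionOfSingularities.ResolutionOfSingularities.Theorems.HomologicalConductorNoZenoSepClosedMinpoly
import HarnessLib

/-!
# Crux `NoZenoR` / `NoZeno` (stmt-ResolutionOfSingularities-19943 / -16483), β2 descent, `stub_L1wCore` (F1) route,
# BC-2 algebra (iii): a compositum `F·L'` with `L` separably closed in `F` and `L'/L` finite separable has `L'` as its
# separable constant field — so the split weight of a base-changed exceptional curve is `[L_j : κ_B]`

OURS (cell res-hironaka, chain W4.4; stub worker res-L0-w44-stub-2 g11; brick DAG `L1W-PREP-v2.md` ba8640c568c3f54d §2.1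
D3/D5, BC-2b (iii)).  Pure field theory over Mathlib; nothing here is a statement of the manuscript under review; AI-written,
weaker than expert review.

Setting (the function field `E = κ(ζ_j) = F·L_j` of a component of a base-changed exceptional curve; `F = κ(η)`, `L = L_η`
its separable constant field, `L' = L_j` a finite separable extension of `L`): a tower of fields `L → F → E` with
`separableClosure L F = ⊥`, a finite separable `L'/L` with `L' → E` over `L`, and `E` generated over `F` by the image of `L'`.

* `mem_range_of_isSeparable_of_adjoin_eq_top` — every element of `E` separable over `L` comes from `L'` (degree count:
  `[F(γ) : F] = [L(γ) : L]` for separable `γ`, `…NoZenoSepClosedMinpoly`, applied to primitive elements);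
* `finrank_eq_of_adjoin_eq_top` — `[E : F] = [L' : L]` (linear disjointness);
* `separableClosure_eq_bot_of_adjoin_eq_top` — `L'` is separably closed in `E`;
* `finrank_separableClosure_eq_of_adjoin_eq_top` — for any subfield `K' → L'` with `L'/K'` separable:
  `[separableClosure K' E : K'] = [L' : K']` — the SPLIT WEIGHT of the component is `[L_j : κ_B]`.
-/

noncomputable section

-- single-problem summit: the doubled namespace component `ResolutionOfSingularities` is forced
set_option linter.dupNamespace false

namespace Summit.ResolutionOfSingularities.ResolutionOfSingularities.Theorems.NoZeno.ExcCount

open Polynomial IntermediateField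

variable {L F E L' : Type*} [Field L] [Field F] [Field E] [Field L'] [Algebra L F] [Algebra F E] [Algebra L E]
  [IsScalarTower L F E] [Algebra L L'] [Algebra L' E] [IsScalarTower L L' E]

/-- Separability transports along the structure map `L' → E` of a tower. [folklore] -/
theorem isSeparable_algebraMap_of_isSeparable [Algebra.IsSeparable L L'] (y : L') :
    IsSeparable L (algebraMap L' E y) := by
  have h := Algebra.IsSeparable.isSeparable L y
  unfold IsSeparable at h ⊢
  rwa [minpoly.algebraMap_eq (algebraMap L' E).injective]

/-- **`L'` catches every `L`-separable element of the compositum `F·L'`** when `L` is separably closed in `F`: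
for a tower `L → F → E`, `separableClosure L F = ⊥`, `L'/L` finite separable with `L' → E` over `L` and
`F(L') = E`, every `β ∈ E` separable over `L` lies in the image of `L'`. [this work] -/
theorem mem_range_of_isSeparable_of_adjoin_eq_top [FiniteDimensional L L'] [Algebra.IsSeparable L L']
    (h0 : separableClosure L F = ⊥)
    (hgen : IntermediateField.adjoin F (Set.range (algebraMap L' E)) = ⊤)
    {β : E} (hβ : IsSeparable L β) : β ∈ Set.range (algebraMap L' E) := by
  -- a primitive element `α` of `L'/L` and its image `γ₀ ∈ E`; the image of `L'` is `L⟮γ₀⟯`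
  obtain ⟨α, hα⟩ := Field.exists_primitive_element L L'
  set γ₀ : E := algebraMap L' E α with hγ₀
  let φ : L' →ₐ[L] E := IsScalarTower.toAlgHom L L' E
  have hrange : Set.range (algebraMap L' E) = (L⟮γ₀⟯ : Set E) := by
    have h1 : (L⟮α⟯).map φ = L⟮γ₀⟯ := by
      rw [IntermediateField.adjoin_map, Set.image_singleton]; rfl
    rw [hα, ← AlgHom.fieldRange_eq_map] at h1   -- φ.fieldRange = L⟮γ₀⟯
    have h2 : (φ.fieldRange : Set E) = Set.range (algebraMap L' E) := by
      ext z; simp [φ]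
    rw [← h2, h1]
  have hγ₀sep : IsSeparable L γ₀ := isSeparable_algebraMap_of_isSeparable (E := E) α
  have hγ₀int : IsIntegral L γ₀ := hγ₀sep.isIntegral
  -- `E = F⟮γ₀⟯`, finite over `F` of degree `[L⟮γ₀⟯ : L]`
  have htop : F⟮γ₀⟯ = ⊤ := by
    rw [eq_top_iff, ← hgen, IntermediateField.adjoin_le_iff, hrange]
    change (L⟮γ₀⟯ : Set E) ⊆ ((F⟮γ₀⟯).restrictScalars L : Set E)
    have : L⟮γ₀⟯ ≤ (F⟮γ₀⟯).restrictScalars L :=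
      IntermediateField.adjoin_le_iff.mpr (by
        simp only [Set.singleton_subset_iff]
        exact IntermediateField.mem_adjoin_simple_self F γ₀)
    exact this
  haveI : FiniteDimensional F F⟮γ₀⟯ := IntermediateField.adjoin.finiteDimensional hγ₀int.tower_top
  haveI : FiniteDimensional F E := by
    have e := (IntermediateField.topEquiv (F := F) (E := E)).toLinearEquiv
    rw [← htop] at e
    exact LinearEquiv.finiteDimensional e
  have hdegE : Module.finrank F E = Module.finrank L L⟮γ₀⟯ := by
    rw [← IntermediateField.finrank_top', ← htop]
    exact finrank_adjoin_simple_eq_of_separableClosure_eq_bot h0 hγ₀sep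
  -- the finite separable subfield `M = L⟮γ₀, β⟯` and a primitive element `γ` of it
  let M : IntermediateField L E := IntermediateField.adjoin L {γ₀, β}
  have hMsep : Algebra.IsSeparable L M := by
    change Algebra.IsSeparable L (IntermediateField.adjoin L ({γ₀, β} : Set E))
    rw [IntermediateField.isSeparable_adjoin_iff_isSeparable]
    intro x hx
    rcases Set.mem_insert_iff.mp hx with rfl | hx'
    · exact hγ₀sep
    · rw [Set.mem_singleton_iff.mp hx']; exact hβ
  haveI := hMsep
  haveI : FiniteDimensional L M := IntermediateField.finiteDimensional_adjoin_pair hγ₀int hβ.isIntegral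
  obtain ⟨γM, hγM⟩ := Field.exists_primitive_element L M
  set γ : E := (γM : E) with hγ
  have hMγ : L⟮γ⟯ = M := by
    have := congrArg IntermediateField.lift hγM
    rwa [IntermediateField.lift_adjoin_simple, IntermediateField.lift_top] at this
  have hγsep : IsSeparable L γ := by
    have h := Algebra.IsSeparable.isSeparable L γM
    have h' : minpoly L (algebraMap (↥M) E γM) = minpoly L γM :=
      minpoly.algebraMap_eq (algebraMap (↥M) E).injective γM
    unfold IsSeparable at h ⊢
    change (minpoly L (algebraMap (↥M) E γM)).Separable
    rw [h']
    exact h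
  -- degree count: `[M : L] = [L⟮γ⟯ : L] = [F⟮γ⟯ : F] ≤ [E : F] = [L⟮γ₀⟯ : L]`
  have h1 : Module.finrank L M = Module.finrank F F⟮γ⟯ := by
    rw [← hMγ]
    exact (finrank_adjoin_simple_eq_of_separableClosure_eq_bot h0 hγsep).symm
  have h2 : Module.finrank F F⟮γ⟯ ≤ Module.finrank F E :=
    Submodule.finrank_le (F⟮γ⟯).toSubalgebra.toSubmodule
  have hle : L⟮γ₀⟯ ≤ M :=
    IntermediateField.adjoin_simple_le_iff.mpr (IntermediateField.subset_adjoin L _ (Set.mem_insert γ₀ {β}))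
  have hMeq : L⟮γ₀⟯ = M := by
    refine IntermediateField.eq_of_le_of_finrank_le hle ?_
    rw [h1, ← hdegE]
    exact h2
  -- hence `β ∈ M = L⟮γ₀⟯ = range`
  have hβM : β ∈ M := IntermediateField.subset_adjoin L _ (by simp)
  rw [hrange]
  rw [← hMeq] at hβM
  exact hβM

/-- **Linear disjointness of the compositum**: `[E : F] = [L' : L]`. [this work] -/
theorem finrank_eq_of_adjoin_eq_top [FiniteDimensional L L'] [Algebra.IsSeparable L L']
    (h0 : separableClosure L F = ⊥)
    (hgen : IntermediateField.adjoin F (Set.range (algebraMap L' E)) = ⊤) :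
    Module.finrank F E = Module.finrank L L' := by
  obtain ⟨α, hα⟩ := Field.exists_primitive_element L L'
  set γ₀ : E := algebraMap L' E α with hγ₀
  have hγ₀sep : IsSeparable L γ₀ := isSeparable_algebraMap_of_isSeparable (E := E) α
  have hγ₀int : IsIntegral L γ₀ := hγ₀sep.isIntegral
  have htop : F⟮γ₀⟯ = ⊤ := by
    rw [eq_top_iff, ← hgen, IntermediateField.adjoin_le_iff]
    rintro _ ⟨y, rfl⟩
    -- `y ∈ L⟮α⟯ = ⊤`, so `algebraMap L' E y ∈ F⟮γ₀⟯`
    have hy : y ∈ L⟮α⟯ := by rw [hα]; exact IntermediateField.mem_top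
    have hmap : (L⟮α⟯).map (IsScalarTower.toAlgHom L L' E) ≤ (F⟮γ₀⟯).restrictScalars L := by
      rw [IntermediateField.adjoin_map, Set.image_singleton]
      refine IntermediateField.adjoin_le_iff.mpr ?_
      simp only [Set.singleton_subset_iff]
      exact IntermediateField.mem_adjoin_simple_self F γ₀
    exact hmap ⟨y, hy, rfl⟩
  haveI : FiniteDimensional F F⟮γ₀⟯ := IntermediateField.adjoin.finiteDimensional hγ₀int.tower_top
  rw [← IntermediateField.finrank_top', ← htop, finrank_adjoin_simple_eq_of_separableClosure_eq_bot h0 hγ₀sep,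
    IntermediateField.adjoin.finrank hγ₀sep.isIntegral, hγ₀, minpoly.algebraMap_eq (algebraMap L' E).injective α,
    ← IntermediateField.adjoin.finrank (Algebra.IsSeparable.isSeparable L α).isIntegral, hα,
    IntermediateField.finrank_top']

/-- **`L'` is separably closed in the compositum `E = F·L'`.** [this work] -/
theorem separableClosure_eq_bot_of_adjoin_eq_top [FiniteDimensional L L'] [Algebra.IsSeparable L L']
    (h0 : separableClosure L F = ⊥)
    (hgen : IntermediateField.adjoin F (Set.range (algebraMap L' E)) = ⊤) :
    separableClosure L' E = ⊥ := by
  rw [eq_bot_iff]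
  intro β hβ
  have hβL : IsSeparable L β :=
    IsSeparable.of_algebra_isSeparable_of_isSeparable L (mem_separableClosure_iff.mp hβ)
  obtain ⟨y, rfl⟩ := mem_range_of_isSeparable_of_adjoin_eq_top h0 hgen hβL
  exact IntermediateField.mem_bot.mpr ⟨y, rfl⟩

/-- **The split weight of the component is `[L' : K']`**: for any field `K'` with `K' → L' → E` a tower and `L'/K'`
separable, `[separableClosure K' E : K'] = [L' : K']`. (In the application `K' = κ_B ⊆ L_j = L'`.) [this work] -/
theorem finrank_separableClosure_eq_of_adjoin_eq_top [FiniteDimensional L L'] [Algebra.IsSeparable L L']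
    (h0 : separableClosure L F = ⊥)
    (hgen : IntermediateField.adjoin F (Set.range (algebraMap L' E)) = ⊤)
    (K' : Type*) [Field K'] [Algebra K' L'] [Algebra K' E] [IsScalarTower K' L' E] [Algebra.IsSeparable K' L'] :
    Module.finrank K' (separableClosure K' E) = Module.finrank K' L' := by
  have hbot := separableClosure_eq_bot_of_adjoin_eq_top (E := E) h0 hgen
  have heq : separableClosure K' E = (separableClosure L' E).restrictScalars K' :=
    separableClosure.eq_restrictScalars_of_isSeparable K' L' E
  rw [heq, hbot]
  -- `(⊥ : IntermediateField L' E).restrictScalars K'` is the image of `L'`, isomorphic to `L'`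
  have e : (⊥ : IntermediateField L' E) ≃ₐ[L'] L' := IntermediateField.botEquiv L' E
  have e' : ↥((⊥ : IntermediateField L' E).restrictScalars K') ≃ₗ[K'] L' :=
    (e.restrictScalars K').toLinearEquiv
  exact e'.finrank_eq

end Summit.ResolutionOfSingularities.ResolutionOfSingularities.Theorems.NoZeno.ExcCount

end
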